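import Literature.MathematicalPhysics.QuantumFieldTheory.Balaban1983to89.T4AxialGaugeSmallField
import Literature.MathematicalPhysics.QuantumFieldTheory.Balaban1983to89.B3TorusRadialSums
import Literature.MathematicalPhysics.QuantumFieldTheory.BalabanImbrieJaffe1984to88.BIJ88Close235Proof

/-!
# `BalabanImbrieJaffe1984to88.BIJ88Ineq217NearPart` — T. Bałaban, J. Imbrie, A. Jaffe, *Effective action and cluster properties of
the abelian Higgs model*, Commun. Math. Phys. **114** (1988) 257–315 [BalabanImbrieJaffe1988]: the NEAR PART `∂□A` of the argument for
**(2.17)** p. 262, CONSTRUCTED on the torus carriers of record (`Setup`: `Plaq P j`, `PBond P j`; `LatticeFieldCalculus.curl`) — with `A`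
replaced by its axial-gauge copy on a non-wrapping box around `p₁`, so that `∂□A` is a curl agreeing with `f^{(k)}` near `p₁` AND
dominated by `‖f^{(k)}‖_∞` (the gauge choice the printed sentence leaves implicit); kernel-checked, constants explicit

statement-level skeleton of published theorems with citation tags; proofs where landed; nothing here is a claim about the Yang–Mills mass gap

PDF held: `paper:balaban1988-cmp114-bij-abelian-higgs-effective-action` (journal page = PDF page + 256); p. 262 [PDF 6] read this session as an
image rendered from the held PDF (seat folder `renders/bij88-p006.png`) and from the text layer.

WHAT IS REPRODUCED.  SKELETON row **C2.Eq2.17** (cell `lit-balaban`, HOME `run/shared/lean/pub/lit-balaban/`; Phase-2 seat p08 gen 6 = unit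
`lit-balaban-p08`; C2 §§1–4 fold owner r18, referee ref-5; TAKING line HOME/STATUS.md 2026-08-21T06:46:30Z), file 2 of 2: the sibling
`BIJ88Ineq217Mechanism` (p253429) proves the printed near/far argument over r18's abstract kernels with the near part `g` as displayed data
(`g` in the class of curls, `g = f` within `r₀` of `p₁`, `‖g‖_∞ ≤ K‖f‖_∞`); this file PRODUCES that data on the torus.
p. 262 [PDF 6], verbatim: *"we shall only encounter situations where f^{(k)}(p₂) = (∂A)(p₂) for p₂ near p₁. Then we prove that
(σ_kf^{(k)})(p₁) ≦ ‖f^{(k)}‖_∞ (2.17) as follows. Write f^{(k)} = ∂□A + f′, where □ is the characteristic function of a neighborhood of p₂. The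
distant part (σ_kf′)(p₁) is easily estimated by ‖f^{(k)}‖_∞ by (2.16). The near part is similarly bounded since σ_k is a bounded operator on
curls [2]."*

READING (the cell's, flagged).  For `∂□A` to be «similarly bounded … by ‖f^{(k)}‖_∞» the cut-off field `□A` must be small where `f = ∂A` is:
on the plaquettes crossing the boundary of `□` the curl `∂(□A)` is a PARTIAL sum of bond variables `A(b)`, not a plaquette variable.  The file
therefore replaces `A` on the box `□ = [z₁ − R, z₁ + R]^d ⊂ T^{(j)}` (non-wrapping: `2R < sitesPerDir j`) by its AXIAL-GAUGE COPY `A′ = A − ∂λ`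
rooted at the corner (`λ` = the tree holonomies of `T4AxialGaugeSmallField.axialGauge`, transported to real-valued vector fields through the
additive reals written multiplicatively, `RAdd`, an instance of `Setup.GaugeGroup` with `dist1 = |·|`): `∂A′ = ∂A` and `|A′(b)| ≤ (d−1)·2R·sup_□|∂A|`
on the bonds of `□` (the lattice Poincaré lemma = `T4AxialGaugeSmallField.dist1_axial_bond_le_uniform` BY NAME).  The near part of record is
`nearCurl c A lo hi := ∂^{c}(□A′)` (`c` = the lattice factor of `LatticeFieldCalculus.curl`).

WHAT IS PROVED HERE (0 `sorry`, standard axioms; definition lane: the model `RAdd`, the dictionary `toU`, and `axialCopy`/`boxCut`/`nearCurl`/`loOf`/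
`hiOf`/`pdist` are definitions with bodies).
§1 `RAdd` (= `Multiplicative ℝ`) as a `GaugeGroup` (`dist1 g = |val g|`, `reTr ≡ 1`); §2 the dictionary `toU A = (b ↦ e^{A(b)})`: `val_plaqHol_toU`
(`U(∂p) ↦ (∂¹A)(p)`), `dist1_plaqHol_toU`, `val_gaugeAct_toU` (`U^u ↦ A − ∂λ`, `LatticeFieldCalculus.gaugeShift`), `curl_one`, `curl_eq_mul`;
§3 `boxPlaqSmall_pull_of_le` (the box hypothesis of `T4AxialGaugeSmallField` from a NON-strict plaquette bound); §4 THE AXIAL COPY: `axialCopy`,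
`curl_axialCopy` (`∂A′ = ∂A`), **`abs_axialCopy_le`** (`|A′(b)| ≤ (d−1)·n·a` on the box bonds if `|∂¹A| ≤ a` on the box plaquettes, box of `n+1`
sites per direction, `n < sitesPerDir j`); §5 THE NEAR PART: `boxCut`, `bonds_mem_boxBonds` (the four bonds of a box plaquette are box bonds),
`curl_boxCut_of_mem`, `nearCurl`, **`nearCurl_mem_range`** (it is a curl), **`nearCurl_eq_of_mem`** (`= ∂^{c}A` on the box plaquettes),
**`abs_nearCurl_le`** (`≤ |c|·4·(d−1)·n·a` everywhere); §6 IN TERMS OF THE PRINTED HYPOTHESIS `f(p₂) = (∂A)(p₂)` on the box: `abs_curl_one_le_of_agree`,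
**`abs_nearCurl_le_supNorm`** / **`supNorm_nearCurl_le`** (`‖∂□A′‖_∞ ≤ 4(d−1)n·‖f‖_∞`, r18's `supNorm`), `nearCurl_agree`; §7 THE NEIGHBOURHOOD:
`loOf`/`hiOf` (the centred box of radius `R`), `exists_lift` (torus sites lift to `ℤ^d` within the torus distance), **`mem_boxPlaqs_of_tdist`**
(`tdist(p₁,p₂) + 1 ≤ R` ⟹ `p₂` is a box plaquette), and the PACKAGE for the sibling's hypotheses with `pdist p q = tdist(p.src, q.src)`,
`r₀ = R`, `K = 8(d−1)R`: **`nearCurl_agree_of_pdist_lt`**, **`supNorm_nearCurl_le_centred`**.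
HONEST SCOPE.  Only the near-part DATA of the printed argument is constructed; (2.16) and «σ_k is a bounded operator on curls [2]» are not touched
(rows C2.Eq2.16, C1); the box must not wrap (`2R < sitesPerDir j`; on a wrapping region no gauge makes `A` small, cf. the caveat of
`T4AxialGaugeSmallField`); constants are explicit and not optimised (corner-rooted tree); r18's real-valued abelian typing (`V = ℝ`).  NOT summit progress.
-/

namespace Literature.MathematicalPhysics.QuantumFieldTheory.BalabanImbrieJaffe1984to88.BIJ88Ineq217NearPart

open Balaban1983to89 hiding Site Plaq
open Balaban1983to89.LatticeFieldCalculus Balaban1983to89.T4AxialGaugeSmallField Balaban1983to89.B3TorusRadialSums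
open BIJ88Sect2Statements BIJ88Close235Proof
open Balaban1983to89.B7Prop1Explicit (e e_apply)
open Balaban1983to89.B8Lemma1NonAbelian (e_nonneg)

noncomputable section

-- The torus carriers of `Setup` under fresh names: inside this namespace the bare names `Site`/`Plaq` resolve to unrelated `ℤ^d` carriers
-- declared at the `QuantumFieldTheory` root by files in the import closure of the axial-gauge machinery.
open Balaban1983to89 renaming Site → TSite, Plaq → TPlaq

/-! ## §1  The abelian Lie-algebra model: the additive reals written multiplicatively, as a `GaugeGroup` -/

/-- The additive group `ℝ` of abelian (u(1)) vector potentials written multiplicatively (`Multiplicative ℝ`), so that the GROUP-valued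
axial-gauge machinery of the series' torus carrier (`GaugeField P j G`) applies to real-valued bond fields: products along contours = sums.
[cite: BalabanImbrieJaffe1988, (2.17) p.262] -/
def RAdd : Type := Multiplicative ℝ

namespace RAdd

/-- The commutative group structure (that of `Multiplicative ℝ`). [cite: BalabanImbrieJaffe1988, (2.17) p.262] -/
instance : CommGroup RAdd := inferInstanceAs (CommGroup (Multiplicative ℝ))

/-- The real number (Lie-algebra element) of a group element. [cite: BalabanImbrieJaffe1988, (2.17) p.262] -/
def val (g : RAdd) : ℝ := Multiplicative.toAdd (show Multiplicative ℝ from g)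

/-- The group element of a real number. [cite: BalabanImbrieJaffe1988, (2.17) p.262] -/
def of (a : ℝ) : RAdd := (Multiplicative.ofAdd a : Multiplicative ℝ)

/-- `val (of a) = a`. [cite: BalabanImbrieJaffe1988, (2.17) p.262] -/
@[simp] theorem val_of (a : ℝ) : (of a).val = a := rfl
/-- Products are sums. [cite: BalabanImbrieJaffe1988, (2.17) p.262] -/
@[simp] theorem val_mul (g h : RAdd) : (g * h).val = g.val + h.val := rfl
/-- Inverses are negatives. [cite: BalabanImbrieJaffe1988, (2.17) p.262] -/
@[simp] theorem val_inv (g : RAdd) : g⁻¹.val = -g.val := rfl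
/-- The unit is `0`. [cite: BalabanImbrieJaffe1988, (2.17) p.262] -/
@[simp] theorem val_one : (1 : RAdd).val = 0 := rfl

/-- `RAdd` as a `Setup.GaugeGroup`: `dist1 g = |val g|` (the abelian `|U − 1| ↦ |A|`), `reTr ≡ 1` (unused bookkeeping).
[cite: BalabanImbrieJaffe1988, (2.17) p.262] -/
instance instGaugeGroup : GaugeGroup RAdd where
  toGroup := inferInstance
  dist1 g := |g.val|
  reTr _ := 1
  dist1_nonneg _ := abs_nonneg _
  dist1_one := by simp only [val_one, abs_zero]
  dist1_inv g := by simp only [val_inv, abs_neg]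
  dist1_conj g h := by rw [mul_comm h g, mul_inv_cancel_right]
  dist1_mul_le g h := by simp only [val_mul]; exact abs_add_le _ _
  reTr_one := rfl
  reTr_le_one _ := le_rfl
  reTr_inv _ := rfl
  reTr_conj _ _ := rfl

/-- `dist1 g = |val g|`. [cite: BalabanImbrieJaffe1988, (2.17) p.262] -/
@[simp] theorem dist1_eq (g : RAdd) : dist1 g = |g.val| := rfl

end RAdd

variable {P : Params} {j : ℕ}

/-! ## §2  The dictionary: real bond fields as `RAdd`-valued gauge fields; plaquette variable = curl; gauge action = `A − ∂λ` -/

/-- A real bond field as an `RAdd`-valued gauge field configuration, `U(b) = e^{A(b)}` (abelian). [cite: BalabanImbrieJaffe1988, (2.17) p.262] -/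
def toU (A : VecField P j ℝ) : GaugeField P j RAdd := fun b => RAdd.of (A b)

/-- `val (toU A b) = A b`. [cite: BalabanImbrieJaffe1988, (2.17) p.262] -/
@[simp] theorem val_toU (A : VecField P j ℝ) (b : PBond P j) : (toU A b).val = A b := rfl

/-- The unit-factor curl is the plaquette sum `A(∂p)`. [cite: BalabanImbrieJaffe1988, (2.17) p.262] -/
theorem curl_one (A : VecField P j ℝ) (p : TPlaq P j) :
    curl 1 A p = A ⟨p.src, p.μ⟩ + A ⟨p.src.shift p.μ, p.ν⟩ - A ⟨p.src.shift p.ν, p.μ⟩ - A ⟨p.src, p.ν⟩ := by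
  simp only [curl, one_smul]

/-- `∂^{c}A = c·∂¹A` (the lattice factor). [cite: BalabanImbrieJaffe1988, (2.17) p.262] -/
theorem curl_eq_mul (c : ℝ) (A : VecField P j ℝ) (p : TPlaq P j) : curl c A p = c * curl 1 A p := by
  simp only [curl, smul_eq_mul, one_mul]

/-- The plaquette variable of `toU A` is the curl: `val U(∂p) = (∂¹A)(p)`. [cite: BalabanImbrieJaffe1988, (2.17) p.262] -/
theorem val_plaqHol_toU (A : VecField P j ℝ) (p : TPlaq P j) : (GaugeField.plaqHol (toU A) p).val = curl 1 A p := by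
  rw [curl_one]
  simp only [GaugeField.plaqHol, RAdd.val_mul, RAdd.val_inv, val_toU]
  ring

/-- `dist1 (U(∂p)) = |(∂¹A)(p)|`. [cite: BalabanImbrieJaffe1988, (2.17) p.262] -/
theorem dist1_plaqHol_toU (A : VecField P j ℝ) (p : TPlaq P j) : dist1 (GaugeField.plaqHol (toU A) p) = |curl 1 A p| := by
  rw [RAdd.dist1_eq, val_plaqHol_toU]

/-- The gauge action is the abelian gauge transformation of `LatticeFieldCalculus`: `val (U^u)(b) = (A − ∂λ)(b)`, `λ = val ∘ u`.
[cite: BalabanImbrieJaffe1988, (2.17) p.262] -/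
theorem val_gaugeAct_toU (u : GaugeTransf P j RAdd) (A : VecField P j ℝ) (b : PBond P j) :
    (GaugeField.gaugeAct u (toU A) b).val = gaugeShift 1 (fun s => (u s).val) A b := by
  simp only [GaugeField.gaugeAct, RAdd.val_mul, RAdd.val_inv, val_toU, gaugeShift, grad, one_smul]
  ring

/-! ## §3  The box hypothesis of `T4AxialGaugeSmallField` from a non-strict plaquette bound -/

/-- `|U(∂p) − 1| ≤ a` on the box plaquettes gives `BoxPlaqSmall (pull U) lo hi a` for the pullback to `ℤ^d` (both orientations).
[cite: BalabanImbrieJaffe1988, (2.17) p.262] -/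
theorem boxPlaqSmall_pull_of_le {G : Type*} [GaugeGroup G] (U : GaugeField P j G) {lo hi : Fin P.d → ℤ} {a : ℝ}
    (hU : ∀ p ∈ boxPlaqs lo hi, dist1 (GaugeField.plaqHol U p) ≤ a) : BoxPlaqSmall (pull U) lo hi a := by
  intro z κ μ hκμ hlo hhi
  rcases lt_or_gt_of_ne hκμ with h | h
  · rw [hol_pull_plaqWord_of_lt U z h]
    exact hU _ ⟨z, hlo, hhi, rfl⟩
  · rw [hol_pull_plaqWord_of_gt U z h, GaugeGroup.dist1_inv]
    exact hU _ ⟨z, hlo, by rwa [add_right_comm], rfl⟩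

/-! ## §4  The axial-gauge copy `A′ = A − ∂λ` of `A` on a box: same curl, bonds dominated by the plaquette variables -/

/-- THE AXIAL-GAUGE COPY of `A` relative to the box `[lo, hi]`: `A′ = A − ∂λ` with `λ` the (real parts of the) tree holonomies of
`T4AxialGaugeSmallField.axialGauge (toU A) lo hi` (corner-rooted axial gauge on the box, `λ = 0` off the box). [cite: BalabanImbrieJaffe1988, (2.17) p.262] -/
def axialCopy (A : VecField P j ℝ) (lo hi : Fin P.d → ℤ) : VecField P j ℝ :=
  gaugeShift 1 (fun s => (axialGauge (toU A) lo hi s).val) A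

/-- `A′(b) = val (toU A)^{axialGauge}(b)`. [cite: BalabanImbrieJaffe1988, (2.17) p.262] -/
theorem axialCopy_apply (A : VecField P j ℝ) (lo hi : Fin P.d → ℤ) (b : PBond P j) :
    axialCopy A lo hi b = (GaugeField.gaugeAct (axialGauge (toU A) lo hi) (toU A) b).val :=
  (val_gaugeAct_toU _ A b).symm

/-- `∂A′ = ∂A` (gauge invariance of the plaquette variable). [cite: BalabanImbrieJaffe1988, (2.17) p.262] -/
theorem curl_axialCopy (c : ℝ) (A : VecField P j ℝ) (lo hi : Fin P.d → ℤ) (p : TPlaq P j) :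
    curl c (axialCopy A lo hi) p = curl c A p :=
  curl_gaugeShift c 1 _ A p

/-- **The lattice Poincaré bound in the axial gauge**: if `|∂¹A| ≤ a` on the plaquettes of the box `[lo, hi]` (`n + 1` sites per direction,
`n < sitesPerDir j`: the box does not wrap), then `|A′(b)| ≤ (d−1)·n·a` on every bond of the box — `T4AxialGaugeSmallField.dist1_axial_bond_le_uniform`
transported through §2–§3. [cite: BalabanImbrieJaffe1988, (2.17) p.262] -/
theorem abs_axialCopy_le {A : VecField P j ℝ} {lo hi : Fin P.d → ℤ} {a : ℝ} {n : ℕ} (ha : 0 ≤ a)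
    (hA : ∀ p ∈ boxPlaqs lo hi, |curl 1 A p| ≤ a) (hn : ∀ κ, hi κ ≤ lo κ + n) (hnN : n < P.sitesPerDir j)
    {b : PBond P j} (hb : b ∈ boxBonds lo hi) : |axialCopy A lo hi b| ≤ ((P.d - 1 : ℕ) : ℝ) * n * a := by
  have hN : ∀ κ, hi κ - lo κ < P.sitesPerDir j := fun κ => by
    have h1 := hn κ
    have h2 : (n : ℤ) < (P.sitesPerDir j : ℤ) := by exact_mod_cast hnN
    linarith
  have hP : BoxPlaqSmall (pull (toU A)) lo hi a :=
    boxPlaqSmall_pull_of_le (toU A) fun p hp => by rw [dist1_plaqHol_toU]; exact hA p hp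
  obtain ⟨x, hx, hxμ, hsrc⟩ := hb
  obtain ⟨src, dir⟩ := b
  simp only at hsrc hxμ
  subst hsrc
  rw [axialCopy_apply, ← RAdd.dist1_eq, gaugeAct_axialGauge_castSite (toU A) hN hx hxμ]
  exact dist1_axial_bond_le_uniform (pull (toU A)) hP ha hn x dir hx hxμ

/-! ## §5  The near part `∂□A′` -/

open Classical in
/-- `□B`: the bond field cut off outside the box bonds (`□` = characteristic function of the neighbourhood). [cite: BalabanImbrieJaffe1988, (2.17) p.262] -/
def boxCut (lo hi : Fin P.d → ℤ) (B : VecField P j ℝ) : VecField P j ℝ := fun b => if b ∈ boxBonds lo hi then B b else 0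

/-- On box bonds `□B = B`. [cite: BalabanImbrieJaffe1988, (2.17) p.262] -/
theorem boxCut_of_mem {lo hi : Fin P.d → ℤ} (B : VecField P j ℝ) {b : PBond P j} (hb : b ∈ boxBonds lo hi) :
    boxCut lo hi B b = B b := by
  simp only [boxCut, if_pos hb]

/-- Off the box bonds `□B = 0`. [cite: BalabanImbrieJaffe1988, (2.17) p.262] -/
theorem boxCut_of_not_mem {lo hi : Fin P.d → ℤ} (B : VecField P j ℝ) {b : PBond P j} (hb : b ∉ boxBonds lo hi) :
    boxCut lo hi B b = 0 := by
  simp only [boxCut, if_neg hb]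

/-- A bound on the box bonds is a bound on `□B` everywhere. [cite: BalabanImbrieJaffe1988, (2.17) p.262] -/
theorem abs_boxCut_le {lo hi : Fin P.d → ℤ} {B : VecField P j ℝ} {D : ℝ} (hD : 0 ≤ D) (hB : ∀ b ∈ boxBonds lo hi, |B b| ≤ D)
    (b : PBond P j) : |boxCut lo hi B b| ≤ D := by
  by_cases hb : b ∈ boxBonds lo hi
  · rw [boxCut_of_mem B hb]; exact hB b hb
  · rw [boxCut_of_not_mem B hb, abs_zero]; exact hD

/-- `|∂^{c}B(p)| ≤ |c|·4·sup|B|`. [cite: BalabanImbrieJaffe1988, (2.17) p.262] -/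
theorem abs_curl_le {c : ℝ} {B : VecField P j ℝ} {D : ℝ} (hB : ∀ b, |B b| ≤ D) (p : TPlaq P j) : |curl c B p| ≤ |c| * (4 * D) := by
  rw [curl_eq_mul, abs_mul]
  refine mul_le_mul_of_nonneg_left ?_ (abs_nonneg c)
  rw [curl_one]
  have h1 := abs_add_le (B ⟨p.src, p.μ⟩) (B ⟨p.src.shift p.μ, p.ν⟩)
  have h2 := abs_sub (B ⟨p.src, p.μ⟩ + B ⟨p.src.shift p.μ, p.ν⟩) (B ⟨p.src.shift p.ν, p.μ⟩)
  have h3 := abs_sub (B ⟨p.src, p.μ⟩ + B ⟨p.src.shift p.μ, p.ν⟩ - B ⟨p.src.shift p.ν, p.μ⟩) (B ⟨p.src, p.ν⟩)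
  linarith [hB ⟨p.src, p.μ⟩, hB ⟨p.src.shift p.μ, p.ν⟩, hB ⟨p.src.shift p.ν, p.μ⟩, hB ⟨p.src, p.ν⟩]

/-- `e_μ + e_ν` raises each coordinate by at most one when `μ ≠ ν`. [cite: BalabanImbrieJaffe1988, (2.17) p.262] -/
theorem e_add_e_apply_le {d : ℕ} {μ ν : Fin d} (h : μ ≠ ν) (κ : Fin d) : e μ κ + e ν κ ≤ 1 := by
  simp only [e_apply]
  split_ifs with h1 h2
  · exact absurd (h1.symm.trans h2) h
  all_goals omega

/-- The four bonds of a box plaquette are box bonds. [cite: BalabanImbrieJaffe1988, (2.17) p.262] -/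
theorem bonds_mem_boxBonds {lo hi : Fin P.d → ℤ} {p : TPlaq P j} (hp : p ∈ boxPlaqs lo hi) :
    (⟨p.src, p.μ⟩ : PBond P j) ∈ boxBonds lo hi ∧ (⟨p.src.shift p.μ, p.ν⟩ : PBond P j) ∈ boxBonds lo hi ∧
      (⟨p.src.shift p.ν, p.μ⟩ : PBond P j) ∈ boxBonds lo hi ∧ (⟨p.src, p.ν⟩ : PBond P j) ∈ boxBonds lo hi := by
  obtain ⟨z, hlo, hhi, hsrc⟩ := hp
  have hμ := e_nonneg p.μ
  have hν := e_nonneg p.ν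
  have hμ' : z ≤ z + e p.μ := le_add_of_nonneg_right hμ
  have hν' : z ≤ z + e p.ν := le_add_of_nonneg_right hν
  have hhi' : z + e p.ν + e p.μ ≤ hi := by rw [add_right_comm]; exact hhi
  refine ⟨⟨z, hlo, ?_, hsrc⟩, ⟨z + e p.μ, hlo.trans hμ', hhi, ?_⟩, ⟨z + e p.ν, hlo.trans hν', hhi', ?_⟩, ⟨z, hlo, ?_, hsrc⟩⟩
  · exact (le_add_of_nonneg_right hν).trans hhi
  · rw [hsrc, castSite_add_e]
  · rw [hsrc, castSite_add_e]
  · exact (le_add_of_nonneg_right hμ).trans hhi'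

/-- On a box plaquette the cut-off is invisible: `∂^{c}(□B)(p) = ∂^{c}B(p)`. [cite: BalabanImbrieJaffe1988, (2.17) p.262] -/
theorem curl_boxCut_of_mem {c : ℝ} {lo hi : Fin P.d → ℤ} (B : VecField P j ℝ) {p : TPlaq P j} (hp : p ∈ boxPlaqs lo hi) :
    curl c (boxCut lo hi B) p = curl c B p := by
  obtain ⟨h1, h2, h3, h4⟩ := bonds_mem_boxBonds hp
  simp only [curl, boxCut_of_mem B h1, boxCut_of_mem B h2, boxCut_of_mem B h3, boxCut_of_mem B h4]

/-- THE NEAR PART OF RECORD, `∂□A′`: the curl (lattice factor `c`) of the cut-off axial copy. [cite: BalabanImbrieJaffe1988, (2.17) p.262] -/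
def nearCurl (c : ℝ) (A : VecField P j ℝ) (lo hi : Fin P.d → ℤ) : TPlaq P j → ℝ := curl c (boxCut lo hi (axialCopy A lo hi))

/-- The near part is a curl («σ_k is a bounded operator on curls»). [cite: BalabanImbrieJaffe1988, (2.17) p.262] -/
theorem nearCurl_mem_range (c : ℝ) (A : VecField P j ℝ) (lo hi : Fin P.d → ℤ) :
    nearCurl c A lo hi ∈ Set.range (curl c : VecField P j ℝ → TPlaq P j → ℝ) :=
  ⟨_, rfl⟩

/-- On the box plaquettes the near part IS `∂A`: `∂□A′(p) = ∂A′(p) = ∂A(p)`. [cite: BalabanImbrieJaffe1988, (2.17) p.262] -/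
theorem nearCurl_eq_of_mem (c : ℝ) (A : VecField P j ℝ) {lo hi : Fin P.d → ℤ} {p : TPlaq P j} (hp : p ∈ boxPlaqs lo hi) :
    nearCurl c A lo hi p = curl c A p := by
  rw [nearCurl, curl_boxCut_of_mem _ hp, curl_axialCopy]

/-- **The near part is small where `∂A` is**: `|∂□A′(p)| ≤ |c|·4·(d−1)·n·a` for EVERY plaquette, given `|∂¹A| ≤ a` on the box plaquettes.
[cite: BalabanImbrieJaffe1988, (2.17) p.262] -/
theorem abs_nearCurl_le {c : ℝ} {A : VecField P j ℝ} {lo hi : Fin P.d → ℤ} {a : ℝ} {n : ℕ} (ha : 0 ≤ a)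
    (hA : ∀ p ∈ boxPlaqs lo hi, |curl 1 A p| ≤ a) (hn : ∀ κ, hi κ ≤ lo κ + n) (hnN : n < P.sitesPerDir j) (p : TPlaq P j) :
    |nearCurl c A lo hi p| ≤ |c| * (4 * (((P.d - 1 : ℕ) : ℝ) * n * a)) :=
  abs_curl_le (abs_boxCut_le (by positivity) fun _ hb => abs_axialCopy_le ha hA hn hnN hb) p

/-! ## §6  In terms of the printed hypothesis «f^{(k)}(p₂) = (∂A)(p₂) for p₂ near p₁» -/

/-- Where `f = ∂^{c}A`, `|∂¹A| ≤ ‖f‖_∞/|c|`. [cite: BalabanImbrieJaffe1988, (2.17) p.262] -/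
theorem abs_curl_one_le_of_agree {c : ℝ} (hc : c ≠ 0) {f : TPlaq P j → ℝ} {A : VecField P j ℝ} {S : Set (TPlaq P j)}
    (hf : ∀ p ∈ S, f p = curl c A p) {p : TPlaq P j} (hp : p ∈ S) : |curl 1 A p| ≤ supNorm f / |c| := by
  rw [le_div_iff₀ (abs_pos.2 hc), ← abs_mul, mul_comm, ← curl_eq_mul, ← hf p hp]
  exact abs_le_supNorm f p

/-- **`|∂□A′(p)| ≤ 4(d−1)n·‖f‖_∞`** for every plaquette, when `f = ∂^{c}A` on the box plaquettes (`c ≠ 0`). [cite: BalabanImbrieJaffe1988, (2.17) p.262] -/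
theorem abs_nearCurl_le_supNorm {c : ℝ} (hc : c ≠ 0) {f : TPlaq P j → ℝ} {A : VecField P j ℝ} {lo hi : Fin P.d → ℤ} {n : ℕ}
    (hf : ∀ p ∈ boxPlaqs lo hi, f p = curl c A p) (hn : ∀ κ, hi κ ≤ lo κ + n) (hnN : n < P.sitesPerDir j) (p : TPlaq P j) :
    |nearCurl c A lo hi p| ≤ 4 * ((P.d - 1 : ℕ) : ℝ) * n * supNorm f := by
  have h := abs_nearCurl_le (c := c) (div_nonneg (supNorm_nonneg f) (abs_nonneg c))
    (fun p hp => abs_curl_one_le_of_agree hc hf hp) hn hnN p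
  have hc' : |c| ≠ 0 := abs_ne_zero.2 hc
  refine h.trans_eq ?_
  field_simp

/-- `‖∂□A′‖_∞ ≤ 4(d−1)n·‖f‖_∞` (r18's `supNorm`). [cite: BalabanImbrieJaffe1988, (2.17) p.262] -/
theorem supNorm_nearCurl_le {c : ℝ} (hc : c ≠ 0) {f : TPlaq P j → ℝ} {A : VecField P j ℝ} {lo hi : Fin P.d → ℤ} {n : ℕ}
    (hf : ∀ p ∈ boxPlaqs lo hi, f p = curl c A p) (hn : ∀ κ, hi κ ≤ lo κ + n) (hnN : n < P.sitesPerDir j) :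
    supNorm (nearCurl c A lo hi) ≤ (4 * ((P.d - 1 : ℕ) : ℝ) * n) * supNorm f :=
  supNorm_le (mul_nonneg (by positivity) (supNorm_nonneg f)) fun p => abs_nearCurl_le_supNorm hc hf hn hnN p

/-- The near part agrees with `f` on the box plaquettes. [cite: BalabanImbrieJaffe1988, (2.17) p.262] -/
theorem nearCurl_agree {c : ℝ} {f : TPlaq P j → ℝ} {A : VecField P j ℝ} {lo hi : Fin P.d → ℤ}
    (hf : ∀ p ∈ boxPlaqs lo hi, f p = curl c A p) {p : TPlaq P j} (hp : p ∈ boxPlaqs lo hi) : f p = nearCurl c A lo hi p := by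
  rw [nearCurl_eq_of_mem c A hp, hf p hp]

/-! ## §7  The neighbourhood of `p₁`: a centred non-wrapping box contains every plaquette within torus distance `R − 1` -/

/-- Lower corner of the box of radius `R` about the `ℤ^d`-point `z₁`. [cite: BalabanImbrieJaffe1988, (2.17) p.262] -/
def loOf (z₁ : Fin P.d → ℤ) (R : ℕ) : Fin P.d → ℤ := fun κ => z₁ κ - R

/-- Upper corner of the box of radius `R` about `z₁`. [cite: BalabanImbrieJaffe1988, (2.17) p.262] -/
def hiOf (z₁ : Fin P.d → ℤ) (R : ℕ) : Fin P.d → ℤ := fun κ => z₁ κ + R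

/-- The centred box has `2R + 1` sites per direction. [cite: BalabanImbrieJaffe1988, (2.17) p.262] -/
theorem hiOf_le (z₁ : Fin P.d → ℤ) (R : ℕ) (κ : Fin P.d) : hiOf z₁ R κ ≤ loOf z₁ R κ + (2 * R : ℕ) := by
  simp only [hiOf, loOf]
  push_cast
  linarith

/-- The torus distance is symmetric. [cite: BalabanImbrieJaffe1988, (2.16) p.261] -/
theorem tdist_comm (x y : TSite P j) : x.tdist y = y.tdist x := by
  unfold Balaban1983to89.Site.tdist
  exact Finset.sum_congr rfl fun μ _ => min_comm _ _

/-- One coordinate's circular distance is at most the torus distance. [cite: BalabanImbrieJaffe1988, (2.16) p.261] -/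
theorem cdist_le_tdist (x y : TSite P j) (κ : Fin P.d) : cdist (x κ - y κ) ≤ x.tdist y := by
  rw [tdist_eq_sum_cdist]
  exact Finset.single_le_sum (f := fun μ => cdist (x μ - y μ)) (fun μ _ => Nat.zero_le _) (Finset.mem_univ κ)

/-- Torus sites lift to `ℤ^d` within the torus distance of a given lift: for `x = castSite z₁` and any `y` there is `z₂` with
`castSite z₂ = y` and `|z₂ − z₁|_κ ≤ tdist(x,y)` in every coordinate. [cite: BalabanImbrieJaffe1988, (2.16) p.261] -/
theorem exists_lift (z₁ : Fin P.d → ℤ) (y : TSite P j) :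
    ∃ z₂ : Fin P.d → ℤ, (castSite z₂ : TSite P j) = y ∧ ∀ κ, |z₂ κ - z₁ κ| ≤ ((castSite z₁ : TSite P j).tdist y : ℤ) := by
  have h : ∀ κ, ∃ o : ℤ, o ∈ Finset.Icc (-((castSite z₁ : TSite P j).tdist y : ℤ)) ((castSite z₁ : TSite P j).tdist y) ∧
      (o : ZMod (P.sitesPerDir j)) = y κ - (castSite z₁ : TSite P j) κ :=
    fun κ => exists_int_of_cdist_le _ _ ((cdist_le_tdist y (castSite z₁) κ).trans (tdist_comm _ _).le)
  choose o ho using h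
  refine ⟨fun κ => z₁ κ + o κ, ?_, fun κ => ?_⟩
  · funext κ
    rw [castSite_apply, Int.cast_add, (ho κ).2, castSite_apply, add_sub_cancel]
  · have h1 := (ho κ).1
    rw [Finset.mem_Icc] at h1
    rw [add_sub_cancel_left]
    exact abs_le.2 h1

/-- **The ball in the box**: if `p₁` is based at `castSite z₁` and `tdist(p₁,p₂) + 1 ≤ R`, then `p₂` is a plaquette of the box of radius `R`
about `z₁` (all four corners in `[z₁ − R, z₁ + R]`). [cite: BalabanImbrieJaffe1988, (2.17) p.262] -/
theorem mem_boxPlaqs_of_tdist {z₁ : Fin P.d → ℤ} {R : ℕ} {p₁ p₂ : TPlaq P j} (h₁ : p₁.src = castSite z₁)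
    (ht : p₁.src.tdist p₂.src + 1 ≤ R) : p₂ ∈ boxPlaqs (loOf z₁ R) (hiOf z₁ R) := by
  obtain ⟨z₂, hz₂, hdist⟩ := exists_lift (j := j) z₁ p₂.src
  rw [h₁] at ht
  have ht' : (((castSite z₁ : TSite P j).tdist p₂.src : ℕ) : ℤ) + 1 ≤ R := by exact_mod_cast ht
  refine ⟨z₂, fun κ => ?_, fun κ => ?_, hz₂.symm⟩
  · have h := hdist κ
    rw [abs_le] at h
    simp only [loOf]
    linarith [h.1]
  · have h := hdist κ
    rw [abs_le] at h
    have he := e_add_e_apply_le (ne_of_lt p₂.hμν) κ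
    simp only [hiOf, Pi.add_apply]
    linarith [h.2]

/-- The plaquette distance of record for the sibling `BIJ88Ineq217Mechanism`: the torus `ℓ¹` distance of the base points.
[cite: BalabanImbrieJaffe1988, (2.16) p.261] -/
def pdist (p q : TPlaq P j) : ℝ := (p.src.tdist q.src : ℝ)

/-- `pdist ≥ 0`. [cite: BalabanImbrieJaffe1988, (2.16) p.261] -/
theorem pdist_nonneg (p q : TPlaq P j) : 0 ≤ pdist p q := Nat.cast_nonneg _

/-- **Package, agreement** (the sibling's `hagree` with `r₀ = R`): if `f = ∂^{c}A` on the box of radius `R` about the base point of `p₁`, then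
`f(p₂) = ∂□A′(p₂)` whenever `pdist(p₁,p₂) < R`. [cite: BalabanImbrieJaffe1988, (2.17) p.262] -/
theorem nearCurl_agree_of_pdist_lt {c : ℝ} {f : TPlaq P j → ℝ} {A : VecField P j ℝ} {z₁ : Fin P.d → ℤ} {R : ℕ} {p₁ : TPlaq P j}
    (h₁ : p₁.src = castSite z₁) (hf : ∀ p ∈ boxPlaqs (loOf z₁ R) (hiOf z₁ R), f p = curl c A p) (p₂ : TPlaq P j)
    (hd : pdist p₁ p₂ < R) : f p₂ = nearCurl c A (loOf z₁ R) (hiOf z₁ R) p₂ := by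
  have ht : p₁.src.tdist p₂.src < R := by
    have hd' : ((p₁.src.tdist p₂.src : ℕ) : ℝ) < R := hd
    exact_mod_cast hd'
  exact nearCurl_agree hf (mem_boxPlaqs_of_tdist h₁ (Nat.succ_le_of_lt ht))

/-- **Package, domination** (the sibling's `hgK` with `K = 8(d−1)R`): on a non-wrapping centred box (`2R < sitesPerDir j`),
`‖∂□A′‖_∞ ≤ 8(d−1)R·‖f‖_∞`. [cite: BalabanImbrieJaffe1988, (2.17) p.262] -/
theorem supNorm_nearCurl_le_centred {c : ℝ} (hc : c ≠ 0) {f : TPlaq P j → ℝ} {A : VecField P j ℝ} {z₁ : Fin P.d → ℤ} {R : ℕ}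
    (hR : 2 * R < P.sitesPerDir j) (hf : ∀ p ∈ boxPlaqs (loOf z₁ R) (hiOf z₁ R), f p = curl c A p) :
    supNorm (nearCurl c A (loOf z₁ R) (hiOf z₁ R)) ≤ (8 * ((P.d - 1 : ℕ) : ℝ) * R) * supNorm f := by
  have h := supNorm_nearCurl_le hc hf (hiOf_le z₁ R) hR
  refine h.trans_eq ?_
  push_cast
  ring

end

end Literature.MathematicalPhysics.QuantumFieldTheory.BalabanImbrieJaffe1984to88.BIJ88Ineq217NearPart
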